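import Mathlib
import Summits.CriticalPhenomena.PercolationContinuityZ3.Theorems.PercNearOneGluingNoHeavyLowerTailFatMinorityAnchoredGluing
import Summits.CriticalPhenomena.PercolationContinuityZ3.Theorems.PercNearOneGluingNoHeavyLowerTailPocketSelTerm
import HarnessLib

/-!
# `NoHeavyLowerTail` (stmt-CriticalPhenomena-4575), line fat-minority-linear — ANCHORED GLUING II:
# per-layer anchors (two steps) and the anchored form at the relay-free pocket — the residual, typed

Route task `nh-dp-fatminority` (gen 1); companion of `…FatMinorityAnchoredGluing.lean` (KN Lemma 5 summed
against a fixed anchor with slack).  Notation as there: `μ = prodBernoulli w`, observer `o`, target `b`,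
`glue`/`kill` written out.

* `twoStepAnchoredGluing` — resolve the open star of `o` (layer `S`, law `ℓ_S`, conditional law
  `P'_S = prodBernoulli (glue (kill w {o}) S)`, `blockLayerDecomposition` with `O = {o}`) and apply
  `anchoredBlockGluing` to every layer with ITS OWN anchor `a_S`, slack `d_S`, target set `R_S`:
  `μ(o ↮ b) ≤ Σ_S ℓ_S (P'_S(a_S ↮ b) + d_S + P'_S(no open pair S–R_S))`.  For observers all of whose
  neighbours are private (adjacent only to `o` and to relays) and the exact per-layer anchor (least
  reliable relay with `o` and `S` deleted, `d_S = 0`, `R_S` = the relays) the right side is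
  `μ(o ↮ A) + Σ_S ℓ_S P'_S(a_S ↮ b)` — the MOVING-ANCHOR BOUND, Kozma–Nitzan's Theorem-5 mechanism for
  any number of private neighbours; `Σ_S ℓ_S P'_S(a_S ↮ b) ≤ C max_a μ(a ↮ b)` is hypothesis HT of
  crux 4576 in linear form (exact numerics on small instances: item evidence of this seat).
* `anchoredPocketGluing` — bookkeeping over the landed per-pocket selection bound `pocketSelTermLe'`
  (exact admissibility): for ANY anchor `a₀` and any family `𝒢` of pocket values at which `a₀` is
  admissible (at most as reliable, with the pocket deleted, as every relay joined to the pocket by a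
  positive pair), with `C*(ω) = {x | o ↔ x in Aᶜ}` the relay-free pocket,
  `μ(o ↔ A, o ↮ b) ≤ μ(a₀ ↮ b) + μ(o ↔ A, o ↮ b, C* ∉ 𝒢)`.
  With `a₀` the worst relay off `o`, the residual of the whole line is the event "the observer is bad
  while its pocket has a potential finger strictly deader, off the pocket, than `a₀`" (the anchor
  moves; HT of crux 4576 and the eaten-pioneer witnesses of `Cruxes/NoHeavyLowerTail/Lines/…-c3.md`
  are instances).  No new definitions.
-/

namespace Summit.CriticalPhenomena.PercolationContinuityZ3.Theorems

open MeasureTheory Set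
open Literature.Probability.LatticeModels (prodBernoulli)
open Literature.Probability.Percolation (BondConfig openConn openConnIn openGraph openGraph_adj pinW
  edgesTouching)
open scoped BigOperators

noncomputable section
open Classical

variable {n : ℕ}

/-! ## The anchored form at the relay-free pocket (exact admissibility): the residual, typed -/

/-- The fibre of the pocket map `ω ↦ {x | o ↔ x in Aᶜ}` (as a finset) over `S` is the event
"the relay-free pocket of `o` is `S`". [folklore] -/
theorem anchoredPocket_fibre_eq (A : Finset (Fin n)) (o : Fin n) (S : Finset (Fin n)) :
    (fun ω : BondConfig (Fin n) =>
        Finset.univ.filter fun x : Fin n => ω ∈ openConnIn (↑A : Set (Fin n))ᶜ o x) ⁻¹' {S} =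
      {ω : BondConfig (Fin n) | ∀ v : Fin n, ω ∈ openConnIn (↑A : Set (Fin n))ᶜ o v ↔ v ∈ S} := by
  ext ω
  simp only [Set.mem_preimage, Set.mem_singleton_iff, Finset.ext_iff, Finset.mem_filter,
    Finset.mem_univ, true_and, Set.mem_setOf_eq]

/-- On the event "the pocket is `S`", `o ∈ S` (if `o ∉ A`) and `S` is disjoint from `A`. [folklore] -/
theorem anchoredPocket_of_mem_fibre {A : Finset (Fin n)} {o : Fin n} (hoA : o ∉ A) {S : Finset (Fin n)}
    {ω : BondConfig (Fin n)}
    (hω : ω ∈ {ω : BondConfig (Fin n) | ∀ v : Fin n, ω ∈ openConnIn (↑A : Set (Fin n))ᶜ o v ↔ v ∈ S}) :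
    o ∈ S ∧ Disjoint S A := by
  have hoAc : o ∈ ((↑A : Set (Fin n))ᶜ : Set (Fin n)) := by simpa using hoA
  refine ⟨(hω o).1 ⟨hoAc, hoAc, SimpleGraph.Reachable.refl _⟩, Finset.disjoint_left.2 fun v hvS hvA => ?_⟩
  obtain ⟨-, hv, -⟩ := (hω v).2 hvS
  exact hv (Finset.mem_coe.2 hvA)

/-- **Anchored gluing at the relay-free pocket (the residual of the line, typed).**  Relay set `A ∋ b`,
observer `o ∉ A`, ANY anchor `a₀`, and any family `𝒢` of pocket values at which `a₀` is ADMISSIBLE: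
for `S ∈ 𝒢`, `a₀` is at most as reliable towards `b`, with all pairs touching `S` closed, as every relay
joined to `S` by a positive-weight pair.  Then, with `C*(ω) = {x | o ↔ x in Aᶜ}` the relay-free pocket,
`μ(o ↔ A, o ↮ b) ≤ μ(a₀ ↮ b) + μ(o ↔ A, o ↮ b, C* ∉ 𝒢)`:
linear gluing holds up to the probability that the observer is bad while its pocket has a potential finger
strictly deader, off the pocket, than the anchor ("the anchor moves").  Bookkeeping over the landed
per-pocket selection bound `pocketSelTermLe'` (Kozma–Nitzan Thm 4 / Lemma 5 in the pocket-contracted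
world). [cite: KozmaNitzan2024, §3.2 Theorem 4 and Lemma 5 (pp. 12–14)] -/
theorem anchoredPocketGluing (w : Sym2 (Fin n) → unitInterval) (A : Finset (Fin n)) (o b a₀ : Fin n)
    (hoA : o ∉ A) (hb : b ∈ A) (𝒢 : Finset (Fin n) → Prop)
    (hadm : ∀ S : Finset (Fin n), 𝒢 S → ∀ v ∈ A, (∃ x ∈ S, w s(x, v) ≠ 0) →
      (prodBernoulli (pinW w (edgesTouching (↑S : Set (Fin n))) (∅ : Set (Sym2 (Fin n))))).real
          (openConn a₀ b) ≤
        (prodBernoulli (pinW w (edgesTouching (↑S : Set (Fin n))) (∅ : Set (Sym2 (Fin n))))).real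
          (openConn v b)) :
    (prodBernoulli w).real ((⋃ a ∈ A, openConn o a) ∩ (openConn o b)ᶜ) ≤
      (prodBernoulli w).real (openConn a₀ b)ᶜ +
        (prodBernoulli w).real (((⋃ a ∈ A, openConn o a) ∩ (openConn o b)ᶜ) ∩
          {ω : BondConfig (Fin n) |
            ¬ 𝒢 (Finset.univ.filter fun x : Fin n => ω ∈ openConnIn (↑A : Set (Fin n))ᶜ o x)}) := by
  set μ := prodBernoulli w with hμ
  set f : BondConfig (Fin n) → Finset (Fin n) :=
    fun ω => Finset.univ.filter fun x : Fin n => ω ∈ openConnIn (↑A : Set (Fin n))ᶜ o x with hf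
  set Bad : Set (BondConfig (Fin n)) := (⋃ a ∈ A, openConn o a) ∩ (openConn o b)ᶜ with hBad
  set NG : Set (BondConfig (Fin n)) := {ω : BondConfig (Fin n) | ¬ 𝒢 (f ω)} with hNG
  -- termwise: on an admissible pocket the per-pocket selection bound, otherwise the residual event
  have hterm : ∀ S : Finset (Fin n), μ.real (f ⁻¹' {S} ∩ Bad) ≤
      μ.real (f ⁻¹' {S} ∩ (openConn a₀ b)ᶜ) + μ.real (f ⁻¹' {S} ∩ (Bad ∩ NG)) := by
    intro S
    have h0a : 0 ≤ μ.real (f ⁻¹' {S} ∩ (openConn a₀ b)ᶜ) := measureReal_nonneg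
    have h0b : 0 ≤ μ.real (f ⁻¹' {S} ∩ (Bad ∩ NG)) := measureReal_nonneg
    by_cases hG : 𝒢 S
    · -- an admissible pocket (if it is a pocket value at all)
      by_cases hfib : (f ⁻¹' {S} : Set (BondConfig (Fin n))).Nonempty
      · obtain ⟨ω₀, hω₀⟩ := hfib
        rw [hf, anchoredPocket_fibre_eq A o S] at hω₀
        obtain ⟨hoS, hSA⟩ := anchoredPocket_of_mem_fibre hoA hω₀
        have key := pocketSelTermLe' n w A S o b a₀ hoS hSA hoA hb (hadm S hG)
        have h1 : μ.real (f ⁻¹' {S} ∩ Bad) ≤ μ.real (f ⁻¹' {S} ∩ (openConn a₀ b)ᶜ) := by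
          rw [Set.inter_comm (f ⁻¹' {S}) Bad, hf, anchoredPocket_fibre_eq A o S]
          refine key.trans (measureReal_mono (fun ω hω => ⟨hω.1, hω.2.2⟩) (measure_ne_top _ _))
        linarith
      · rw [Set.not_nonempty_iff_eq_empty] at hfib
        rw [hfib, Set.empty_inter, Set.empty_inter, Set.empty_inter, measureReal_empty]
        linarith
    · -- a non-admissible pocket: the whole term is part of the residual event
      have h1 : μ.real (f ⁻¹' {S} ∩ Bad) ≤ μ.real (f ⁻¹' {S} ∩ (Bad ∩ NG)) := by
        refine measureReal_mono (fun ω hω => ⟨hω.1, hω.2, ?_⟩) (measure_ne_top _ _)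
        have hfS : f ω = S := hω.1
        show ¬ 𝒢 (f ω)
        rw [hfS]
        exact hG
      linarith
  have hsum := Finset.sum_le_sum fun S (_ : S ∈ (Finset.univ : Finset (Finset (Fin n)))) => hterm S
  rw [Finset.sum_add_distrib, sigmaRec_sum_preimage_inter w f Bad,
    sigmaRec_sum_preimage_inter w f (openConn a₀ b)ᶜ,
    sigmaRec_sum_preimage_inter w f (Bad ∩ NG)] at hsum
  exact hsum

/-! ## Two steps: per-layer anchors (the moving anchor made explicit) -/

/-- **Two-step anchored gluing (per-layer anchors, slacks and targets).**  Resolve the open star of the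
observer `o`: its LAYER is `S = {x ≠ o | o–x open}`, with law `ℓ_S = μ(layer = S)`, and given the layer
the configuration off `o` has the law `P'_S = prodBernoulli (glue (kill w {o}) S)` (the star of `o`
deleted, the layer glued; `blockLayerDecomposition` with `O = {o}`).  Applying `anchoredBlockGluing` to
every layer `S ∌ b` with its own anchor `a_S ∉ S`, slack `d_S ≥ 0` and target set `R_S` (disjoint from
`S`, each `v ∈ R_S` at least as reliable as `a_S` up to `d_S` once `o` AND `S` are deleted) gives
`μ(o ↮ b) ≤ Σ_S ℓ_S · (P'_S(a_S ↮ b) + d_S + P'_S(no open pair from S into R_S))`.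
With a CONSTANT anchor this is `anchoredGluing` one layer further out; with the exact per-layer anchor
(the least reliable relay with `o` and `S` deleted, `d_S = 0`, `R_S =` all relays outside `S`) the right
side is `μ(o ↮ A) + Σ_S ℓ_S P'_S(a_S ↮ b)` for observers all of whose neighbours are private — the
"moving-anchor bound", Kozma–Nitzan's Theorem 5 mechanism for any number of private neighbours; whether
it is `≤ C · max_a μ(a ↮ b)` is exactly hypothesis HT of crux 4576 in linear form.
[cite: KozmaNitzan2024, §3.2 Theorem 5 and Lemma 5 (pp. 13–14)] -/
theorem twoStepAnchoredGluing (w : Sym2 (Fin n) → unitInterval) (o b : Fin n) (hbo : b ≠ o)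
    (aS : Finset (Fin n) → Fin n) (dS : Finset (Fin n) → ℝ) (RS : Finset (Fin n) → Finset (Fin n))
    (hd : ∀ S, 0 ≤ dS S)
    (haS : ∀ S : Finset (Fin n), S.Nonempty → b ∉ S → aS S ∉ S)
    (hRS : ∀ S : Finset (Fin n), S.Nonempty → b ∉ S → Disjoint (RS S) S)
    (hadm : ∀ S : Finset (Fin n), S.Nonempty → b ∉ S → ∀ v ∈ RS S,
      (prodBernoulli (fun e : Sym2 (Fin n) => if (∃ x ∈ e, x ∈ S) then 0 else
          if (∃ x ∈ e, x ∈ ({o} : Finset (Fin n))) then 0 else w e)).real (openConn (aS S) b) ≤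
        (prodBernoulli (fun e : Sym2 (Fin n) => if (∃ x ∈ e, x ∈ S) then 0 else
          if (∃ x ∈ e, x ∈ ({o} : Finset (Fin n))) then 0 else w e)).real (openConn v b) + dS S) :
    (prodBernoulli w).real (openConn o b)ᶜ ≤
      ∑ S : Finset (Fin n),
        (prodBernoulli w).real
            {ω : BondConfig (Fin n) | ∀ x : Fin n, x ∈ S ↔ (x ∉ ({o} : Finset (Fin n)) ∧
              ∃ o' ∈ ({o} : Finset (Fin n)), s(o', x) ∈ ω)} *
          ((prodBernoulli (fun e : Sym2 (Fin n) => if (∀ x ∈ e, x ∈ S) ∧ ¬ e.IsDiag then 1 else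
              if (∃ x ∈ e, x ∈ ({o} : Finset (Fin n))) then 0 else w e)).real (openConn (aS S) b)ᶜ +
            dS S +
            (prodBernoulli (fun e : Sym2 (Fin n) => if (∀ x ∈ e, x ∈ S) ∧ ¬ e.IsDiag then 1 else
              if (∃ x ∈ e, x ∈ ({o} : Finset (Fin n))) then 0 else w e)).real
              {ω : BondConfig (Fin n) | ∀ s ∈ S, ∀ v ∈ RS S, s(s, v) ∉ ω}) := by
  set k₀ : Sym2 (Fin n) → unitInterval :=
    fun e => if (∃ x ∈ e, x ∈ ({o} : Finset (Fin n))) then 0 else w e with hk₀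
  set q : Finset (Fin n) → Sym2 (Fin n) → unitInterval := fun S e =>
    if (∀ x ∈ e, x ∈ S) ∧ ¬ e.IsDiag then 1 else if (∃ x ∈ e, x ∈ ({o} : Finset (Fin n))) then 0 else w e
    with hq
  set ℓ : Finset (Fin n) → ℝ := fun S =>
    (prodBernoulli (fun e : Sym2 (Fin n) =>
      if (∀ x ∈ e, x ∈ ({o} : Finset (Fin n))) ∧ ¬ e.IsDiag then 1 else w e)).real
      {ω : BondConfig (Fin n) | ∀ x : Fin n, x ∈ S ↔ (x ∉ ({o} : Finset (Fin n)) ∧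
        ∃ o' ∈ ({o} : Finset (Fin n)), s(o', x) ∈ ω)} with hℓ
  set β : Finset (Fin n) → ℝ := fun S => (prodBernoulli (q S)).real (⋃ s ∈ S, openConn s b) with hβ
  have hbO : b ∉ ({o} : Finset (Fin n)) := by simpa using hbo
  obtain ⟨hone, -, -, hbsum, -⟩ :=
    blockLayerDecomposition n w {o} ∅ b b (Finset.disjoint_empty_right _) hbO hbO
  change ∑ S : Finset (Fin n), ℓ S = 1 at hone
  change (prodBernoulli (fun e : Sym2 (Fin n) =>
      if (∀ x ∈ e, x ∈ ({o} : Finset (Fin n))) ∧ ¬ e.IsDiag then 1 else w e)).real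
      (⋃ o' ∈ ({o} : Finset (Fin n)), openConn o' b) = ∑ S : Finset (Fin n), ℓ S * β S at hbsum
  rw [agPartial_glue_singleton w o, Finset.set_biUnion_singleton] at hbsum
  have hℓw : ∀ S, ℓ S = (prodBernoulli w).real
      {ω : BondConfig (Fin n) | ∀ x : Fin n, x ∈ S ↔ (x ∉ ({o} : Finset (Fin n)) ∧
        ∃ o' ∈ ({o} : Finset (Fin n)), s(o', x) ∈ ω)} := fun S => by
    simp only [hℓ, agPartial_glue_singleton w o]
  have hℓ0 : ∀ S, 0 ≤ ℓ S := fun S => measureReal_nonneg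
  have hLHS : (prodBernoulli w).real (openConn o b)ᶜ = ∑ S : Finset (Fin n), ℓ S * (1 - β S) := by
    rw [probReal_compl_eq_one_sub MeasurableSet.of_discrete, hbsum]
    simp only [mul_sub, mul_one, Finset.sum_sub_distrib, hone]
  have hbb : ∀ ω : BondConfig (Fin n), ω ∈ (openConn b b : Set (BondConfig (Fin n))) :=
    fun ω => (SimpleGraph.Reachable.refl b : (openGraph ω).Reachable b b)
  -- termwise
  have hterm : ∀ S : Finset (Fin n), ℓ S * (1 - β S) ≤
      ℓ S * ((prodBernoulli (q S)).real (openConn (aS S) b)ᶜ + dS S +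
        (prodBernoulli (q S)).real {ω : BondConfig (Fin n) | ∀ s ∈ S, ∀ v ∈ RS S, s(s, v) ∉ ω}) := by
    intro S
    refine mul_le_mul_of_nonneg_left ?_ (hℓ0 S)
    have h0a : 0 ≤ (prodBernoulli (q S)).real (openConn (aS S) b)ᶜ := measureReal_nonneg
    have h0c : 0 ≤ (prodBernoulli (q S)).real
        {ω : BondConfig (Fin n) | ∀ s ∈ S, ∀ v ∈ RS S, s(s, v) ∉ ω} := measureReal_nonneg
    rcases S.eq_empty_or_nonempty with hSe | hSne
    · -- the empty layer: the "no open pair" event is everything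
      subst hSe
      have h1 : (prodBernoulli (q ∅)).real
          {ω : BondConfig (Fin n) | ∀ s ∈ (∅ : Finset (Fin n)), ∀ v ∈ RS ∅, s(s, v) ∉ ω} = 1 := by
        have : {ω : BondConfig (Fin n) | ∀ s ∈ (∅ : Finset (Fin n)), ∀ v ∈ RS ∅, s(s, v) ∉ ω} =
            Set.univ := by
          ext ω; simp
        rw [this, probReal_univ]
      have hβ0 : 0 ≤ β ∅ := measureReal_nonneg
      linarith [hd ∅]
    by_cases hbS : b ∈ S
    · have hβ1 : 1 ≤ β S :=
        calc (1 : ℝ) = (prodBernoulli (q S)).real Set.univ := probReal_univ.symm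
          _ ≤ β S := measureReal_mono (fun ω _ => Set.mem_iUnion₂.2 ⟨b, hbS, hbb ω⟩)
              (measure_ne_top _ _)
      linarith [hd S]
    · have key := anchoredBlockGluing k₀ S (RS S) (aS S) b (dS S) (hd S) (haS S hSne hbS) hbS
        (hRS S hSne hbS) (hadm S hSne hbS)
      have hcS : (prodBernoulli (q S)).real (⋃ s ∈ S, openConn s b)ᶜ = 1 - β S :=
        probReal_compl_eq_one_sub MeasurableSet.of_discrete
      change (prodBernoulli (q S)).real (⋃ s ∈ S, openConn s b)ᶜ ≤
        (prodBernoulli (q S)).real (openConn (aS S) b)ᶜ + dS S +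
          (prodBernoulli (q S)).real {ω : BondConfig (Fin n) | ∀ s ∈ S, ∀ v ∈ RS S, s(s, v) ∉ ω}
        at key
      linarith
  rw [hLHS]
  refine (Finset.sum_le_sum fun S _ => hterm S).trans (le_of_eq ?_)
  refine Finset.sum_congr rfl fun S _ => ?_
  rw [hℓw S]

end

end Summit.CriticalPhenomena.PercolationContinuityZ3.Theorems
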